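import Literature.Analysis.FunctionSpaces.TorusCubeCutoffCommutator
import Literature.Analysis.FunctionSpaces.TorusFourierModes
import Literature.Analysis.FunctionSpaces.TorusVectorParseval
import Literature.Analysis.FunctionSpaces.TorusCalculusProofs
import HarnessLib

/-!
# Localisation of the transport flux into a cube-cut-off energy: bulk commutator + far-mode remainder

Analysis/FunctionSpaces proof file (everything proved; no definitions, no named facts).  For `u ∈ L²(T^d; ℝ^d)` with Fourier
coefficients `X`, a continuous weakly divergence-free drift `b` with `‖b x − b y‖ ≤ Λ ‖reprc(x − y)‖`, and the smoothed cube
cut-off `χ = cubeSym K Δ` (`TorusCubeCutoffCommutator`), the transport flux into the `χ²`-weighted Galerkin energy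
(`FluidPDE.PassiveVectorTensorWeightedGalerkinIdentity`: `Fl = ∫ ⟨u, (b·∇) P_{χ²} u⟩`, `P_w u = realTrigPoly (w • X)`) is
LOCALISED in frequency:

* `abs_cubeFlux_sub_remainder_le` — for any even weight `χ'` with finite symmetric support and `χ'·χ = χ` (the previous
  rung of a ladder), `Fl = MAIN + Σₐ ∫ bₐ ⟨u − P_{χ'}u, ∂ₐ P_{χ²}u⟩` with
  `|MAIN| ≤ (4π d² Λ (K+2Δ)/Δ) ‖P_{χ'}u‖₂ ‖P_χ u‖₂`: the bulk is the commutator `Σₐ ⟨[χ, bₐ] P_{χ'}u, ∂ₐ P_χ u⟩`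
  (`abs_cubeSym_commutator_pairing_le`; the self-pairing `∫ ⟨P_χ u, (b·∇)P_χ u⟩` vanishes along a weakly divergence-free
  drift, `integral_inner_convect_self_eq_zero_of_isWeaklyDivFree`), the derivative costing only the band limit `K + 2Δ`;
* `abs_integral_mul_inner_realTrigPoly_le_of_coeff_vanish` — the TAIL TOOL for the remainder: if the coefficients of `v ∈ L²`
  vanish on `B + S` and `β` is within `ε` (sup norm) of a band-limited `(realTrigPoly B t)ₐ`, then `|∫ β ⟨v, P⟩| ≤ ε ‖v‖₂ ‖P‖₂`
  for `P = realTrigPoly S c` (the modes of `β` below the gap cannot connect `v` to `P`).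

So a rung is fed by the previous rung through the Lipschitz constant of the drift, by farther rungs only through the sup-norm spectral
tail of the drift beyond the gap. Consumer: cell `ad-ideate`, K1L_D `stmt-AnomalousDissipation-27980`, `stub_effectiveFrameEnergyL_bandKill` (F-k3l-7).
## Mathlib / tree search
Tree: `TorusCubeCutoffCommutator`, `Torus.realTrigPoly` API, `Torus.hasSum_re_inner_mFourierCoeff_complexify`, `Torus.mFourierCoeff_sum_mFourier_smul`,
`Torus.fderiv_apply_eq_sum_partialDeriv`, `Torus.fderiv_norm_sq_apply`.  Mathlib: `integral_mul_le_Lp_mul_Lq_of_nonneg`, `Finset.sum_product`.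
## References
* R. J. DiPerna, P.-L. Lions, Invent. Math. 98 (1989), §II.1 Lemma II.1. [`DiPernaLions1989`]
* P. Constantin, W. E, E. S. Titi, Comm. Math. Phys. 165 (1994), (9)–(10). [`ConstantinETiti1994`]
* R. Temam, *Navier–Stokes Equations* (1984), Ch. II §1.2 Lemma 1.3. [`Temam1984`] -/

noncomputable section

open MeasureTheory Set Filter Complex UnitAddTorus Function Finset
open scoped ENNReal InnerProductSpace ComplexConjugate

namespace Literature.Analysis.FunctionSpaces
namespace Torus

variable {d : Type*} [Fintype d] [DecidableEq d]

/-! ## §9 Tools: antisymmetry along a weakly divergence-free drift; convection of trigonometric polynomials; pairings -/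

section FluxTools

open EuclideanSpace

omit [DecidableEq d] in
/-- **Antisymmetry along a weakly divergence-free continuous drift**: `∫ ⟨G, (b·∇)G⟩ = 0` for smooth `G`
(`⟨G, (b·∇)G⟩ = ½ b·∇‖G‖²`, tested against the smooth function `‖G‖²`). [cite: Temam1984, Ch. II §1.2 Lemma 1.3] -/
theorem integral_inner_convect_self_eq_zero_of_isWeaklyDivFree {b : UnitAddTorus d → EuclideanSpace ℝ d}
    (hdiv : IsWeaklyDivFree b) {G : UnitAddTorus d → EuclideanSpace ℝ d} (hG : IsSmooth G) :
    ∫ x, ⟪G x, convect b G x⟫_ℝ = 0 := by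
  have h : ∀ x, ⟪G x, convect b G x⟫_ℝ = 2⁻¹ * ⟪b x, Torus.gradient (fun y => ‖G y‖ ^ 2) x⟫_ℝ := by
    intro x
    rw [← real_inner_comm (b x) _, inner_gradient_left, fderiv_norm_sq_apply (hG.isContDiff (by simp))]
    simp only [convect]
    ring
  simp_rw [h, integral_const_mul, hdiv _ hG.norm_sq, mul_zero]

/-- **Convection of a real trigonometric polynomial**: `(b·∇) realTrigPoly S c = Σₐ bₐ · realTrigPoly S ((2πi kₐ) • c)`.
[cite: Grafakos2014, §3.1.1] -/
theorem convect_realTrigPoly (b : UnitAddTorus d → EuclideanSpace ℝ d) (S : Finset (d → ℤ))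
    (c : (d → ℤ) → EuclideanSpace ℂ d) (x : UnitAddTorus d) :
    convect b (realTrigPoly S c) x = ∑ a, b x a • realTrigPoly S (fun k => (2 * Real.pi * Complex.I * (k a)) • c k) x := by
  rw [convect, fderiv_apply_eq_sum_partialDeriv ((isSmooth_realTrigPoly S c).isContDiff (by simp))]
  refine Finset.sum_congr rfl fun a _ => ?_
  rw [partialDeriv_realTrigPoly]

omit [DecidableEq d] in
/-- Real trigonometric polynomials over two index sets agree when the coefficients vanish off the intersection.
[cite: Grafakos2014, §3.1.1] -/
theorem realTrigPoly_eq_of_vanish {S S' : Finset (d → ℤ)} {c : (d → ℤ) → EuclideanSpace ℂ d}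
    (h1 : ∀ k ∈ S, k ∉ S' → c k = 0) (h2 : ∀ k ∈ S', k ∉ S → c k = 0) :
    realTrigPoly S c = realTrigPoly S' c := by
  classical
  have e1 : trigPoly (S ∪ S') c = trigPoly S c :=
    trigPoly_subset Finset.subset_union_left fun k hk hkS => by
      rcases Finset.mem_union.1 hk with h | h
      · exact absurd h hkS
      · exact h2 k h hkS
  have e2 : trigPoly (S ∪ S') c = trigPoly S' c :=
    trigPoly_subset Finset.subset_union_right fun k hk hkS' => by
      rcases Finset.mem_union.1 hk with h | h
      · exact h1 k h hkS'
      · exact absurd h hkS'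
  rw [realTrigPoly_eq_comp, realTrigPoly_eq_comp, ← e1, e2]

omit [DecidableEq d] in
/-- Integrability of the flux pairings: `x ↦ β x · ⟨u x, Φ x⟩` is integrable for `u ∈ L²` and continuous `β`, `Φ`.
[cite: Temam1984, Ch. II §1.2 Lemma 1.3] -/
theorem integrable_mul_inner {u : UnitAddTorus d → EuclideanSpace ℝ d} (hu : MemLp u 2 volume)
    {β : UnitAddTorus d → ℝ} (hβ : Continuous β) {Φ : UnitAddTorus d → EuclideanSpace ℝ d} (hΦ : Continuous Φ) :
    Integrable (fun x => β x * ⟪u x, Φ x⟫_ℝ) volume := by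
  obtain ⟨Cβ, hCβ⟩ := (isCompact_univ.image hβ).isBounded.exists_norm_le
  obtain ⟨CΦ, hCΦ⟩ := (isCompact_univ.image hΦ).isBounded.exists_norm_le
  have hCβ' : ∀ x, ‖β x‖ ≤ Cβ := fun x => hCβ _ ⟨x, Set.mem_univ _, rfl⟩
  have hCΦ' : ∀ x, ‖Φ x‖ ≤ CΦ := fun x => hCΦ _ ⟨x, Set.mem_univ _, rfl⟩
  have hC0 : 0 ≤ Cβ := (norm_nonneg _).trans (hCβ' 0)
  have hui : Integrable u volume := hu.integrable one_le_two
  refine Integrable.mono' ((hui.norm.const_mul (Cβ * CΦ))) ?_ (ae_of_all _ fun x => ?_)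
  · exact (hβ.aestronglyMeasurable.mul (hu.aestronglyMeasurable.inner hΦ.aestronglyMeasurable))
  · rw [norm_mul]
    calc ‖β x‖ * ‖⟪u x, Φ x⟫_ℝ‖ ≤ Cβ * (‖u x‖ * ‖Φ x‖) :=
          mul_le_mul (hCβ' x) (norm_inner_le_norm _ _) (norm_nonneg _) hC0
      _ ≤ Cβ * (‖u x‖ * CΦ) := by gcongr; exact hCΦ' x
      _ = Cβ * CΦ * ‖u x‖ := by ring

end FluxTools

/-! ## §10 The localised flux bound of the cube cut-off -/

section Flux

open EuclideanSpace

/-- **THE LOCALISED CUBE FLUX DECOMPOSITION.**  Let `u ∈ L²(T^d; ℝ^d)` with coefficients `X = 𝓕u`, `b` a continuous weakly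
divergence-free drift with `‖b x − b y‖ ≤ Λ ‖reprc(x − y)‖`, `χ = cubeSym K Δ` (`Δ ≥ 1`, carried by `F = cubeSupp (K+2Δ)`), and
`χ'` a real even weight carried by a symmetric finite `F'` with `χ' · χ = χ` (the "previous rung":
`χ' = 1` on the support of `χ`).  Then the transport flux into the `χ²`-weighted energy,
`Fl = ∫ ⟨u, (b·∇) P_{χ²} u⟩` (`P_w u = realTrigPoly (w • X)`), splits as

  `Fl = MAIN + Σₐ ∫ bₐ ⟨u − P_{χ'} u, Φₐ⟩`,   `Φₐ = ∂ₐ P_{χ²} u`,   `|MAIN| ≤ (4π d² Λ (K+2Δ)/Δ) · ‖P_{χ'} u‖₂ · ‖P_χ u‖₂`: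

the BULK of the flux is a commutator `Σₐ ⟨[χ, bₐ] P_{χ'}u, ∂ₐ P_χ u⟩` (the self-pairing `⟨P_χ u, (b·∇)P_χ u⟩` vanishes,
`integral_inner_convect_self_eq_zero_of_isWeaklyDivFree`), controlled by the LIPSCHITZ constant of `b` through
`abs_cubeSym_commutator_pairing_le` and by the band limitation `|kₐ| ≤ K + 2Δ` of `P_χ u`; the REMAINDER only sees the part of
`u` outside the previous rung and is left to the caller (orthogonality against far Fourier modes of `b`,
`abs_integral_mul_inner_le_of_vanish`). [cite: DiPernaLions1989, §II.1 Lemma II.1] [cite: ConstantinETiti1994, (9)–(10)] -/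
theorem abs_cubeFlux_sub_remainder_le (K : ℕ) {Δ : ℕ} (hΔ : 0 < Δ)
    {b : UnitAddTorus d → EuclideanSpace ℝ d} (hbc : Continuous b) (hdiv : IsWeaklyDivFree b) {Λ : ℝ} (hΛ : 0 ≤ Λ)
    (hbL : ∀ x y, ‖b x - b y‖ ≤ Λ * ‖reprc (x - y)‖)
    {u : UnitAddTorus d → EuclideanSpace ℝ d} (hu : MemLp u 2 volume)
    {χ' : (d → ℤ) → ℝ} {F' : Finset (d → ℤ)} (hF' : ∀ k ∈ F', -k ∈ F') (hχ'F' : ∀ k, k ∉ F' → χ' k = 0)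
    (hχ'ev : ∀ k, χ' (-k) = χ' k) (hχχ' : ∀ k, χ' k * cubeSym K Δ k = cubeSym K Δ k) :
    |(∫ x, ⟪u x, convect b (realTrigPoly (cubeSupp d (K + 2 * Δ))
        (fun k => (((cubeSym K Δ k) ^ 2 : ℝ) : ℂ) • mFourierCoeff (EuclideanSpace.complexify ∘ u) k)) x⟫_ℝ) -
      ∑ a, ∫ x, b x a * ⟪u x - realTrigPoly F' (fun k => ((χ' k : ℝ) : ℂ) • mFourierCoeff (EuclideanSpace.complexify ∘ u) k) x,
        realTrigPoly (cubeSupp d (K + 2 * Δ)) (fun k => (2 * Real.pi * Complex.I * (k a)) •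
          ((((cubeSym K Δ k) ^ 2 : ℝ) : ℂ) • mFourierCoeff (EuclideanSpace.complexify ∘ u) k)) x⟫_ℝ| ≤
      4 * Real.pi * (Fintype.card d) ^ 2 * Λ * (K + 2 * Δ) / Δ *
        Real.sqrt (∑ k ∈ F', ‖((χ' k : ℝ) : ℂ) • mFourierCoeff (EuclideanSpace.complexify ∘ u) k‖ ^ 2) *
        Real.sqrt (∑ k ∈ cubeSupp d (K + 2 * Δ), ‖((cubeSym K Δ k : ℝ) : ℂ) • mFourierCoeff (EuclideanSpace.complexify ∘ u) k‖ ^ 2) := by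
  -- notation
  set F : Finset (d → ℤ) := cubeSupp d (K + 2 * Δ) with hF
  set X : (d → ℤ) → EuclideanSpace ℂ d := mFourierCoeff (EuclideanSpace.complexify ∘ u) with hX
  set χ : (d → ℤ) → ℝ := cubeSym K Δ with hχ
  have hFsym : ∀ k ∈ F, -k ∈ F := fun k hk => neg_mem_cubeSupp hk
  have hXc : IsConjSymm X := isConjSymm_mFourierCoeff (hu.integrable one_le_two)
  -- coefficient families
  set cg : (d → ℤ) → EuclideanSpace ℂ d := fun k => ((χ' k : ℝ) : ℂ) • X k with hcg        -- g = P_{χ'} u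
  set cG : (d → ℤ) → EuclideanSpace ℂ d := fun k => ((χ k : ℝ) : ℂ) • X k with hcG          -- G = P_χ u
  set θ : d → (d → ℤ) → EuclideanSpace ℂ d := fun a k => (2 * Real.pi * Complex.I * (k a)) • cG k with hθ   -- ∂ₐ G
  set g : UnitAddTorus d → EuclideanSpace ℝ d := realTrigPoly F' cg with hg
  set G : UnitAddTorus d → EuclideanSpace ℝ d := realTrigPoly F cG with hG
  have hcgc : IsConjSymm cg := hXc.real_weight hχ'ev
  have hcGc : IsConjSymm cG := hXc.real_weight (cubeSym_neg K Δ)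
  have hθc : ∀ a, IsConjSymm (θ a) := fun a => hcGc.deriv a
  -- the test field and its derivatives: `P_{χ²} u` has coefficients `χ • cG`, `∂ₐ P_{χ²} u` has coefficients `χ • θ a`
  have hP : (fun k => (((χ k) ^ 2 : ℝ) : ℂ) • X k) = fun k => ((χ k : ℝ) : ℂ) • cG k := by
    funext k; simp only [hcG, smul_smul]; congr 1; push_cast; ring
  have hΦ : ∀ a, (fun k => (2 * Real.pi * Complex.I * (k a)) • ((((χ k) ^ 2 : ℝ) : ℂ) • X k)) =
      fun k => ((χ k : ℝ) : ℂ) • θ a k := by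
    intro a; funext k; simp only [hθ, hcG, smul_smul]; congr 1; push_cast; ring
  simp_rw [hΦ]
  rw [hP]
  have hba : ∀ a, Continuous fun x => b x a := fun a => (PiLp.continuous_apply 2 (fun _ : d => ℝ) a).comp hbc
  -- (a) the flux as a sum over the axes
  have hconv : ∀ x, convect b (realTrigPoly F (fun k => ((χ k : ℝ) : ℂ) • cG k)) x =
      ∑ a, b x a • realTrigPoly F (fun k => ((χ k : ℝ) : ℂ) • θ a k) x := by
    intro x
    rw [convect_realTrigPoly]
    refine Finset.sum_congr rfl fun a _ => ?_
    rw [realTrigPoly_congr (S := F) (c' := fun k => ((χ k : ℝ) : ℂ) • θ a k) (fun k _ => by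
      simp only [hθ, hcG, smul_smul]; congr 1; ring)]
  have hflux : (∫ x, ⟪u x, convect b (realTrigPoly F (fun k => ((χ k : ℝ) : ℂ) • cG k)) x⟫_ℝ) =
      ∑ a, ∫ x, b x a * ⟪u x, realTrigPoly F (fun k => ((χ k : ℝ) : ℂ) • θ a k) x⟫_ℝ := by
    simp_rw [hconv, inner_sum, real_inner_smul_right]
    rw [integral_finsetSum]
    exact fun a _ => integrable_mul_inner (β := fun x => b x a) hu (hba a) (continuous_realTrigPoly _ _)
  -- (b) split `u = g + (u − g)` in each pairing
  have hsplit : ∀ a, (∫ x, b x a * ⟪u x, realTrigPoly F (fun k => ((χ k : ℝ) : ℂ) • θ a k) x⟫_ℝ) =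
      (∫ x, b x a * ⟪g x, realTrigPoly F (fun k => ((χ k : ℝ) : ℂ) • θ a k) x⟫_ℝ) +
      ∫ x, b x a * ⟪u x - g x, realTrigPoly F (fun k => ((χ k : ℝ) : ℂ) • θ a k) x⟫_ℝ := by
    intro a
    rw [← integral_add (integrable_mul_inner (β := fun x => b x a) (u := g) (memLp_realTrigPoly F' cg 2) (hba a)
        (continuous_realTrigPoly _ _))
      (integrable_mul_inner (β := fun x => b x a) (u := fun x => u x - g x) (hu.sub (memLp_realTrigPoly F' cg 2)) (hba a)
        (continuous_realTrigPoly _ _))]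
    refine integral_congr_ae (ae_of_all _ fun x => ?_)
    dsimp only
    rw [← mul_add, ← inner_add_left, add_sub_cancel]
  -- (c) the bulk: commutator + vanishing self-pairing
  have hΘnorm : ∀ a, Real.sqrt (∑ k ∈ F, ‖θ a k‖ ^ 2) ≤ 2 * Real.pi * (K + 2 * Δ) * Real.sqrt (∑ k ∈ F, ‖cG k‖ ^ 2) := by
    intro a
    rw [← Real.sqrt_sq (show (0:ℝ) ≤ 2 * Real.pi * (K + 2 * Δ) by positivity), ← Real.sqrt_mul (sq_nonneg _), Finset.mul_sum]
    refine Real.sqrt_le_sqrt (Finset.sum_le_sum fun k hk => ?_)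
    rw [hθ]; dsimp only
    rw [norm_smul, mul_pow]
    refine mul_le_mul_of_nonneg_right ?_ (sq_nonneg _)
    have hka : |(k a : ℝ)| ≤ K + 2 * Δ := by
      have := (mem_cubeSupp.1 hk) a
      exact_mod_cast this
    have hn : ‖(2 * Real.pi * Complex.I * (k a) : ℂ)‖ = 2 * Real.pi * |(k a : ℝ)| := by
      rw [norm_mul, norm_mul, norm_mul, Complex.norm_I, mul_one, Complex.norm_intCast, Complex.norm_real, Real.norm_eq_abs,
        Complex.norm_ofNat, abs_of_pos Real.pi_pos]
    rw [hn]
    exact pow_le_pow_left₀ (by positivity) (by nlinarith [Real.pi_pos, abs_nonneg (k a : ℝ)]) 2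
  -- `χ g = G` (as functions) and `realTrigPoly F θ_a = ∂ₐ G`
  have hχg : realTrigPoly F' (fun k => ((χ k : ℝ) : ℂ) • cg k) = G := by
    have hcoef : (fun k => ((χ k : ℝ) : ℂ) • cg k) = cG := by
      funext k; rw [hcg, hcG]; dsimp only; rw [smul_smul, ← Complex.ofReal_mul, mul_comm, hχχ']
    rw [hcoef, hG]
    refine realTrigPoly_eq_of_vanish (fun k _ hkF => ?_) (fun k _ hkF' => ?_)
    · show ((χ k : ℝ) : ℂ) • X k = 0
      rw [hχ, cubeSym_eq_zero_of_not_mem hkF, Complex.ofReal_zero, zero_smul]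
    · show ((χ k : ℝ) : ℂ) • X k = 0
      rw [← hχχ' k, hχ'F' k hkF', zero_mul, Complex.ofReal_zero, zero_smul]
  have hself : ∑ a, ∫ x, b x a * ⟪realTrigPoly F' (fun k => ((χ k : ℝ) : ℂ) • cg k) x, realTrigPoly F (θ a) x⟫_ℝ = 0 := by
    simp_rw [hχg]
    have e : ∀ x, ∑ a, b x a * ⟪G x, realTrigPoly F (θ a) x⟫_ℝ = ⟪G x, convect b G x⟫_ℝ := by
      intro x
      rw [hG, convect_realTrigPoly, inner_sum]
      refine Finset.sum_congr rfl fun a _ => ?_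
      rw [real_inner_smul_right]
    rw [← integral_finsetSum _ fun a _ => integrable_mul_inner (β := fun x => b x a) (u := G) (memLp_realTrigPoly F cG 2)
      (hba a) (continuous_realTrigPoly _ _)]
    simp_rw [e]
    exact integral_inner_convect_self_eq_zero_of_isWeaklyDivFree hdiv (hG ▸ isSmooth_realTrigPoly F cG)
  -- assemble
  rw [hflux]
  simp_rw [hsplit]
  rw [Finset.sum_add_distrib, add_sub_cancel_right]
  -- `Σ_a M_a = Σ_a Comm_a + 0`
  have hM : ∑ a, ∫ x, b x a * ⟪g x, realTrigPoly F (fun k => ((χ k : ℝ) : ℂ) • θ a k) x⟫_ℝ =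
      ∑ a, ((∫ x, b x a * ⟪g x, realTrigPoly F (fun k => ((χ k : ℝ) : ℂ) • θ a k) x⟫_ℝ) -
        ∫ x, b x a * ⟪realTrigPoly F' (fun k => ((χ k : ℝ) : ℂ) • cg k) x, realTrigPoly F (θ a) x⟫_ℝ) := by
    rw [Finset.sum_sub_distrib, hself, sub_zero]
  rw [hM]
  refine (Finset.abs_sum_le_sum_abs _ _).trans ?_
  have hbaL : ∀ a x y, |b x a - b y a| ≤ Λ * ‖reprc (x - y)‖ := fun a x y =>
    (by simpa using PiLp.norm_apply_le (b x - b y) a : |b x a - b y a| ≤ ‖b x - b y‖).trans (hbL x y)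
  have hcomm : ∀ a, |(∫ x, b x a * ⟪g x, realTrigPoly F (fun k => ((χ k : ℝ) : ℂ) • θ a k) x⟫_ℝ) -
      ∫ x, b x a * ⟪realTrigPoly F' (fun k => ((χ k : ℝ) : ℂ) • cg k) x, realTrigPoly F (θ a) x⟫_ℝ| ≤
      2 * Fintype.card d * Λ / Δ * Real.sqrt (∑ k ∈ F', ‖cg k‖ ^ 2) * Real.sqrt (∑ k ∈ F, ‖θ a k‖ ^ 2) := fun a =>
    abs_cubeSym_commutator_pairing_le K hΔ (hba a) hΛ (hbaL a) hF' hFsym hcgc (hθc a)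
  refine (Finset.sum_le_sum fun a _ => (hcomm a).trans (mul_le_mul_of_nonneg_left (hΘnorm a) (by positivity))).trans ?_
  rw [Finset.sum_const, Finset.card_univ, nsmul_eq_mul]
  have hΔ0 : (0 : ℝ) < Δ := by exact_mod_cast hΔ
  have h0 : 0 ≤ Real.sqrt (∑ k ∈ F', ‖cg k‖ ^ 2) * Real.sqrt (∑ k ∈ F, ‖cG k‖ ^ 2) := by positivity
  calc (Fintype.card d : ℝ) * (2 * Fintype.card d * Λ / Δ * Real.sqrt (∑ k ∈ F', ‖cg k‖ ^ 2) *
        (2 * Real.pi * (K + 2 * Δ) * Real.sqrt (∑ k ∈ F, ‖cG k‖ ^ 2)))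
      = 4 * Real.pi * (Fintype.card d) ^ 2 * Λ * (K + 2 * Δ) / Δ *
          Real.sqrt (∑ k ∈ F', ‖cg k‖ ^ 2) * Real.sqrt (∑ k ∈ F, ‖cG k‖ ^ 2) := by ring
    _ ≤ _ := le_rfl

end Flux


/-! ## §11 The orthogonality tail tool: far Fourier modes of the multiplier do not see a band-limited pairing -/

section Tail

open EuclideanSpace

omit [DecidableEq d] in
/-- A single mode times a real trigonometric polynomial, complexified: for conjugate-symmetric `t` on a symmetric `B`
and conjugate-symmetric `c` on a symmetric `S`,
`complexify ((realTrigPoly B t x)ₐ • realTrigPoly S c x) = Σ_{y∈B} Σ_{k∈S} e_{y+k}(x) • ((t y)ₐ • c k)`.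
[cite: Grafakos2014, §3.1.1] -/
theorem complexify_coord_smul_realTrigPoly {B S : Finset (d → ℤ)} (hB : ∀ k ∈ B, -k ∈ B) (hS : ∀ k ∈ S, -k ∈ S)
    {t c : (d → ℤ) → EuclideanSpace ℂ d} (ht : IsConjSymm t) (hc : IsConjSymm c) (a : d) (x : UnitAddTorus d) :
    EuclideanSpace.complexify ((realTrigPoly B t x a) • realTrigPoly S c x) =
      ∑ y ∈ B, ∑ k ∈ S, mFourier (y + k) x • ((t y a) • c k) := by
  rw [map_smul, complexify_realTrigPoly hS hc x]
  -- the scalar `(realTrigPoly B t x)ₐ` is the (real) complex number `(trigPoly B t x)ₐ`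
  have hreal : ((realTrigPoly B t x a : ℝ) : ℂ) = trigPoly B t x a := by
    have h := congrArg (fun w : EuclideanSpace ℂ d => w a) (complexify_realTrigPoly hB ht x)
    simpa [EuclideanSpace.complexify_apply] using h
  rw [← Complex.coe_smul, hreal]
  have hcoord : trigPoly B t x a = ∑ y ∈ B, mFourier y x * t y a := by
    simp [trigPoly_apply, WithLp.ofLp_sum, Finset.sum_apply]
  rw [hcoord, trigPoly_apply, Finset.sum_smul]
  refine Finset.sum_congr rfl fun y _ => ?_
  rw [Finset.smul_sum]
  refine Finset.sum_congr rfl fun k _ => ?_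
  rw [smul_smul, mFourier_add, smul_smul]
  congr 1
  ring

omit [DecidableEq d] in
/-- The Fourier coefficients of the product: `𝓕(Tₐ • P)(m) = Σ_{y∈B} Σ_{k∈S} [m = y + k] (t y)ₐ • c k`.
[cite: Grafakos2014, §3.1.1] -/
theorem mFourierCoeff_coord_smul_realTrigPoly {B S : Finset (d → ℤ)} (hB : ∀ k ∈ B, -k ∈ B) (hS : ∀ k ∈ S, -k ∈ S)
    {t c : (d → ℤ) → EuclideanSpace ℂ d} (ht : IsConjSymm t) (hc : IsConjSymm c) (a : d) (m : d → ℤ) :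
    mFourierCoeff (EuclideanSpace.complexify ∘ fun x => (realTrigPoly B t x a) • realTrigPoly S c x) m =
      ∑ y ∈ B, ∑ k ∈ S, if m = y + k then (t y a) • c k else 0 := by
  classical
  have e : (EuclideanSpace.complexify ∘ fun x => (realTrigPoly B t x a) • realTrigPoly S c x) =
      fun x => ∑ p ∈ B ×ˢ S, mFourier (p.1 + p.2) x • ((t p.1 a) • c p.2) := by
    funext x
    rw [Function.comp_apply, complexify_coord_smul_realTrigPoly hB hS ht hc a x, Finset.sum_product]
  rw [e, mFourierCoeff_sum_mFourier_smul, Finset.sum_product]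
  refine Finset.sum_congr rfl fun y _ => Finset.sum_congr rfl fun k _ => ?_
  by_cases h : y + k = m
  · rw [if_pos h, if_pos h.symm]
  · rw [if_neg h, if_neg (Ne.symm h)]

omit [DecidableEq d] in
/-- **Orthogonality**: if the coefficients of `v ∈ L²` vanish on `B + S`, then `∫ Tₐ ⟨v, P⟩ = 0` for `T = realTrigPoly B t`,
`P = realTrigPoly S c`. [cite: Grafakos2014, Prop. 3.2.7 (3)] -/
theorem integral_coord_mul_inner_realTrigPoly_eq_zero {v : UnitAddTorus d → EuclideanSpace ℝ d} (hv : MemLp v 2 volume)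
    {B S : Finset (d → ℤ)} (hB : ∀ k ∈ B, -k ∈ B) (hS : ∀ k ∈ S, -k ∈ S)
    {t c : (d → ℤ) → EuclideanSpace ℂ d} (ht : IsConjSymm t) (hc : IsConjSymm c) (a : d)
    (hvan : ∀ y ∈ B, ∀ k ∈ S, mFourierCoeff (EuclideanSpace.complexify ∘ v) (y + k) = 0) :
    ∫ x, realTrigPoly B t x a * ⟪v x, realTrigPoly S c x⟫_ℝ = 0 := by
  have hW : MemLp (fun x => (realTrigPoly B t x a) • realTrigPoly S c x) 2 volume :=
    ((((PiLp.continuous_apply 2 (fun _ : d => ℝ) a).comp (continuous_realTrigPoly B t)).smul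
      (continuous_realTrigPoly S c)).memLp_of_hasCompactSupport (HasCompactSupport.of_compactSpace _))
  have h := hasSum_re_inner_mFourierCoeff_complexify hv hW
  simp_rw [real_inner_smul_right] at h
  have h0 : ∀ m, (inner ℂ (mFourierCoeff (EuclideanSpace.complexify ∘ v) m)
      (mFourierCoeff (EuclideanSpace.complexify ∘ fun x => (realTrigPoly B t x a) • realTrigPoly S c x) m)).re = 0 := by
    intro m
    rw [mFourierCoeff_coord_smul_realTrigPoly hB hS ht hc a m, inner_sum, Complex.re_sum]
    refine Finset.sum_eq_zero fun y hy => ?_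
    rw [inner_sum, Complex.re_sum]
    refine Finset.sum_eq_zero fun k hk => ?_
    split_ifs with hm
    · rw [hm, hvan y hy k hk, inner_zero_left, Complex.zero_re]
    · rw [inner_zero_right, Complex.zero_re]
  simp_rw [h0] at h
  exact (hasSum_zero.unique h).symm

omit [DecidableEq d] in
/-- **THE TAIL TOOL**: if the coefficients of `v ∈ L²` vanish on `B + S` and `β` is within `ε` of the band-limited
`Tₐ = (realTrigPoly B t)ₐ` in the sup norm, then `|∫ β ⟨v, P⟩| ≤ ε ‖v‖₂ ‖P‖₂` for `P = realTrigPoly S c`.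
[cite: DiPernaLions1989, §II.1 Lemma II.1] -/
theorem abs_integral_mul_inner_realTrigPoly_le_of_coeff_vanish {v : UnitAddTorus d → EuclideanSpace ℝ d}
    (hv : MemLp v 2 volume) {β : UnitAddTorus d → ℝ} (hβ : Continuous β)
    {B S : Finset (d → ℤ)} (hB : ∀ k ∈ B, -k ∈ B) (hS : ∀ k ∈ S, -k ∈ S)
    {t c : (d → ℤ) → EuclideanSpace ℂ d} (ht : IsConjSymm t) (hc : IsConjSymm c) (a : d)
    (hvan : ∀ y ∈ B, ∀ k ∈ S, mFourierCoeff (EuclideanSpace.complexify ∘ v) (y + k) = 0)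
    {ε : ℝ} (hε : ∀ x, |β x - realTrigPoly B t x a| ≤ ε) :
    |∫ x, β x * ⟪v x, realTrigPoly S c x⟫_ℝ| ≤
      ε * Real.sqrt (∫ x, ‖v x‖ ^ 2) * Real.sqrt (∑ k ∈ S, ‖c k‖ ^ 2) := by
  set P := realTrigPoly S c with hP
  set T : UnitAddTorus d → ℝ := fun x => realTrigPoly B t x a with hT
  have hTc : Continuous T := (PiLp.continuous_apply 2 (fun _ : d => ℝ) a).comp (continuous_realTrigPoly B t)
  have hPc : Continuous P := continuous_realTrigPoly S c
  have hε0 : 0 ≤ ε := (abs_nonneg _).trans (hε 0)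
  -- subtract the orthogonal part
  have horth := integral_coord_mul_inner_realTrigPoly_eq_zero hv hB hS ht hc a hvan
  have hi1 : Integrable (fun x => β x * ⟪v x, P x⟫_ℝ) volume := integrable_mul_inner hv hβ hPc
  have hi2 : Integrable (fun x => T x * ⟪v x, P x⟫_ℝ) volume := integrable_mul_inner hv hTc hPc
  have e : (∫ x, β x * ⟪v x, P x⟫_ℝ) = ∫ x, (β x - T x) * ⟪v x, P x⟫_ℝ := by
    rw [show (fun x => (β x - T x) * ⟪v x, P x⟫_ℝ) = fun x => β x * ⟪v x, P x⟫_ℝ - T x * ⟪v x, P x⟫_ℝ by funext x; ring,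
      integral_sub hi1 hi2, horth, sub_zero]
  rw [e]
  -- Cauchy–Schwarz
  have hnorm := norm_integral_le_integral_norm (μ := (volume : Measure (UnitAddTorus d))) (fun x => (β x - T x) * ⟪v x, P x⟫_ℝ)
  simp only [Real.norm_eq_abs] at hnorm
  refine hnorm.trans ?_
  have hpt : ∀ x, |(β x - T x) * ⟪v x, P x⟫_ℝ| ≤ ε * (‖v x‖ * ‖P x‖) := fun x => by
    rw [abs_mul]
    exact mul_le_mul (hε x) (abs_real_inner_le_norm _ _) (abs_nonneg _) hε0
  have h1 : MemLp (fun x => ‖v x‖) (ENNReal.ofReal 2) volume := by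
    rw [show ENNReal.ofReal 2 = 2 by norm_num]; exact hv.norm
  have h2 : MemLp (fun x => ‖P x‖) (ENNReal.ofReal 2) volume := by
    rw [show ENNReal.ofReal 2 = 2 by norm_num]
    exact hPc.norm.memLp_of_hasCompactSupport (HasCompactSupport.of_compactSpace _)
  have hcs := integral_mul_le_Lp_mul_Lq_of_nonneg Real.HolderConjugate.two_two
    (ae_of_all _ fun x => norm_nonneg (v x)) (ae_of_all _ fun x => norm_nonneg (P x)) h1 h2
  have e1 : ∫ x, ‖v x‖ ^ (2:ℝ) = ∫ x, ‖v x‖ ^ 2 := by simp_rw [Real.rpow_two]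
  have e2 : ∫ x, ‖P x‖ ^ (2:ℝ) = ∫ x, ‖P x‖ ^ 2 := by simp_rw [Real.rpow_two]
  rw [e1, e2, ← Real.sqrt_eq_rpow, ← Real.sqrt_eq_rpow, hP, integral_norm_sq_realTrigPoly hS hc] at hcs
  have hgi : Integrable (fun x => ε * (‖v x‖ * ‖P x‖)) volume := by
    refine Integrable.const_mul ?_ _
    have := (integral_mul_le_Lp_mul_Lq_of_nonneg Real.HolderConjugate.two_two
      (ae_of_all _ fun x => norm_nonneg (v x)) (ae_of_all _ fun x => norm_nonneg (P x)) h1 h2)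
    -- integrability of `‖v‖ ‖P‖`: `v ∈ L¹` and `P` bounded
    obtain ⟨CP, hCP⟩ := (isCompact_univ.image hPc).isBounded.exists_norm_le
    exact ((hv.integrable one_le_two).norm.mul_const CP).mono'
      ((hv.aestronglyMeasurable.norm.mul hPc.aestronglyMeasurable.norm))
      (ae_of_all _ fun x => by
        rw [Real.norm_eq_abs, abs_mul, abs_norm, abs_norm]
        exact mul_le_mul_of_nonneg_left (hCP _ ⟨x, Set.mem_univ _, rfl⟩) (norm_nonneg _))
  refine (integral_mono_of_nonneg (ae_of_all _ fun x => abs_nonneg _) hgi (ae_of_all _ hpt)).trans ?_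
  rw [integral_const_mul, mul_assoc]
  exact mul_le_mul_of_nonneg_left hcs hε0

end Tail

end Torus
end Literature.Analysis.FunctionSpaces

end
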